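import Literature.Analysis.InnerProduct.FiveDimensionalIsospectralLensSpaces
import Literature.Analysis.InnerProduct.IkedaIsospectralNonIsometricExistenceThree
import HarnessLib

/-!
# Ikeda's Proposition 1.6 (`Ψ_{q,4}` is determined by `Σ|A_q(triples)|` and `|A_q(ω)|`) and his Theorem 3.1 (iii): for every
# prime `q ≥ 17` there are two `(q − 10)`-dimensional lens spaces with fundamental group of order `q` which are isospectral
# but not isometric (Ikeda 1980)

Layer `Literature/Analysis/InnerProduct`, namespace `Literature.Analysis.InnerProduct`; lane `lit-hodgefound`, prover seat
`lit-hodgefound-p06`, generation 46, row g46-#2. THEOREMS only (no definition, no instance, no notation, no named fact).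
Companion of `FiveDimensionalIsospectralLensSpaces.lean` (row g44-#4: Proposition 1.7, `k = 3`, and the sums
`sum_Ico_cos_two_pi_mul_div_eq`, `sum_Ico_cos_mul_cos_mul_cos`), `IkedaIsospectralNonIsometricExistence.lean` (row g44-#13:
Theorem 3.1 (i), `LensWeightsEquivalent.of_append`) and `IkedaIsospectralNonIsometricExistenceThree.lean` (row g45-#10:
Theorem 3.1 (ii), `IsIkedaWeights.append_comm`). With this file all three parts of Ikeda's Theorem 3.1 are tree theorems.

## Source, verbatim (held text `paper:doi-10-24033-asens-1384`)

A. Ikeda, *On lens spaces which are isospectral but not isometric*, Ann. Sci. ÉNS (4) **13** (1980) 303–315. §1 (p. 306–308):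
"**Proposition 1.2.** If we put `Ψ_{q,k}((p₁, …, p_k)) = ∑_{i=0}^{2k}(−1)ⁱaᵢz^{2k−i}`, then we have: (i) `aᵢ = a_{2k−i}`; (ii)
`a₀ = (q−1)`; (iii) `a₁ = −2k`; (iv) `a₂ = k(q − 2k + 1)`. … Let `p₁, p₂, p₃` be integers with `(p₁, p₂, p₃) ∈ Ĩ₀(q, 3)` and
`s₁, s₂, s₃, s₄` be integers with `(s₁, s₂, s₃, s₄) ∈ Ĩ₀(q, 4)`. We define the sets `A_q(p₁, p₂, p₃)` and `A_q(s₁, s₂, s₃, s₄)`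
by `A_q(p₁, p₂, p₃) = {(ξ, μ) : p₁ + ξp₂ + μp₃ ≡ 0 (mod q), ξ, μ ∈ {−1, 1}}`, `A_q(s₁, s₂, s₃, s₄) = {(ξ, μ, ν) :
s₁ + ξs₂ + μs₃ + νs₄ ≡ 0 (mod q), ξ, μ, ν ∈ {−1, 1}}`, respectively. **Lemma 1.4.** For any element `(p₁, p₂, p₃) ∈ Ĩ₀(q, 3)`,
we have `|A_q(p₁, p₂, p₃)| ≤ 1`. **Lemma 1.5.** For any element `(p₁, p₂, p₃, p₄) ∈ Ĩ₀(q, 4)`, we have (i)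
`|A_q(p₁, p₂, p₃, p₄)| ≤ 1`; (ii) `Σ_{1≤l₁<l₂<l₃≤4}|A_q(p_{l₁}, p_{l₂}, p_{l₃})| ≤ 2`. … We shall compute the coefficients `a₃`, `a₄`
of the polynomial `Ψ_{q,4}((p₁, p₂, p₃, p₄))`: `a₃ = ∑_{l=1}^{q−1}{∑_{1≤i₁<i₂<i₃≤4}∑γ^{(±p_{i₁}±p_{i₂}±p_{i₃})l} + 6∑_{i=1}^{4}∑γ^{±pᵢl}}
= 2(q−1)Σ|A_q(p_{i₁},p_{i₂},p_{i₃})| − 2(16 − Σ|A_q(p_{i₁},p_{i₂},p_{i₃})|) − 24`, … `a₄ = … = 2q|A_q(p₁,p₂,p₃,p₄)| + 6q − 70`.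
Hence we have: **Proposition 1.6.** Let `(p₁, p₂, p₃, p₄), (s₁, s₂, s₃, s₄) ∈ I₀(q, 4)`. Then we have
`Ψ_{q,4}((p₁, p₂, p₃, p₄)) = Ψ_{q,4}((s₁, s₂, s₃, s₄))` if and only if (i)
`Σ_{1≤l₁<l₂<l₃≤4}|A_q(p_{l₁},p_{l₂},p_{l₃})| = Σ_{1≤l₁<l₂<l₃≤4}|A_q(s_{l₁},s_{l₂},s_{l₃})|` and (ii)
`|A_q(p₁,p₂,p₃,p₄)| = |A_q(s₁,s₂,s₃,s₄)|`. … From Lemma 1.4, 1.5 and Proposition 1.6, 1.7, we have: **Proposition 1.9.** (i) let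
`q` be a prime not less than 11, then we have `|J(q, 3)| ≤ 2`; (ii) let `q` be a prime not less than 13 then we have
`|J(q, 4)| ≤ 6`." §3 (p. 311): "**Theorem 3.1.** … (iii) let `q` be a prime not less than `17`. Then there exist at least two
`(q − 10)`-dimensional lens spaces with fundamental groups of order `q` which are isospectral but not isometric."

## The computation and what is proved

`∏_{j<4}(z² − a_jz + 1) = ∑_{m=0}^{4}(−1)^m e_m z^m(z²+1)^{4−m} = (z⁸+1) − e₁(z⁷+z) + (4 + e₂)(z⁶+z²) − (3e₁ + e₃)(z⁵+z³) +
(6 + 2e₂ + e₄)z⁴` with `e_m` the elementary symmetric functions of `aⱼ = 2cos(2πlωⱼ/q)` (`prod_fin_four_quadratic`); summing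
over `l = 1, …, q − 1`: `∑e₁ = −8`, `∑e₂ = −24` (`∑_l cos = −1`, `∑_l cos·cos = −1`), `∑e₃ = 8·∑_{triples}(q|A_q| − 4)/4 =
2qΣ|A_q(triples)| − 32` (`sum_Ico_cos_mul_cos_mul_cos`), `∑e₄ = 16·(q|A_q(ω)| − 8)/8 = 2q|A_q(ω)| − 16`
(`sum_Ico_cos_mul_cos_mul_cos_mul_cos`: `∏_{j<4}cos x_j = ⅛∑_±cos(x₁ ± x₂ ± x₃ ± x₄)`). Hence
* §1 **`IsIkedaWeights.ikedaPolynomial_fin_four`**: `Ψ_{q,4}(ω) = (q−1)(z⁸+1) + 8(z⁷+z) + (4q−28)(z⁶+z²) +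
  (56 − 2qΣ|A_q(triples)|)(z⁵+z³) + (2q|A_q(ω)| + 6q − 70)z⁴` (Proposition 1.2 (i)–(iv) for `k = 4` with the source's `a₃ =
  2qΣ|A_q| − 56`, `a₄ = 2q|A_q| + 6q − 70`), **`IsIkedaWeights.ikedaPolynomial_fin_four_eq`** (PROPOSITION 1.6, the direction
  (i) ∧ (ii) ⇒ `Ψ_{q,4}(ω) = Ψ_{q,4}(ω')`); the indicator counts are written out as sums of sixteen resp. eight indicators.
* §2 the witnesses `(1, 2, 3, 7)`, `(1, 2, 3, 8) ∈ Ĩ₀(q, 4)` (`q ≥ 11`, resp. `q ≥ 13`), and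
  **`not_lensWeightsEquivalent_one_two_three_seven_one_two_three_eight`** (not equivalent for any prime `q ≥ 7`: power sums of
  degree `2, 4, 6` give `63 ≡ 78l²`, `2499 ≡ 4194l⁴`, `118443 ≡ 262938l⁶`, whence `q ∣ 1442070 = 2·3³·5·7²·109` and
  `q ∣ 9539495550 = 2·3⁴·5²·13·409·443`, i.e. `q ∣ 270`).
* §3 **`exists_isospectral_not_lensWeightsEquivalent_four`** — THEOREM 3.1 (iii) for EVERY prime `q ≥ 17`: both witnesses have
  `Σ|A_q(triples)| = 1` (the single relation `1 + 2 − 3 = 0`; every other signed sub-sum is a nonzero integer of absolute value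
  `≤ 14 < q`) and `|A_q| = 0`, so by Proposition 1.6 and Proposition 2.6 (`lensSpaceMultiplicity_eq_iff_ikedaPolynomial_eq`) their
  complements in a full system of residues — two weight systems of `Ĩ₀(q, (q − 9)/2)`, i.e. `(q − 10)`-dimensional lens spaces —
  are isospectral, and they are not equivalent (Theorem 2.1: not isometric) since equivalence passes to complements. The
  source proves (iii) by counting, `|𝓛₀(q, 4)| > 6 ≥ |J(q, 4)|` (Proposition 1.9 (ii)); the explicit pair is a witness of that
  pigeonhole, uniform in `q` — a documented shorter road.
Not formalised: the converse direction of Proposition 1.6, Lemma 1.5, Proposition 1.9.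

## References

* [Ikeda1980] A. Ikeda, *On lens spaces which are isospectral but not isometric*, Ann. Sci. ÉNS (4) 13 (1980) 303–315,
  Proposition 1.2, Lemmas 1.4–1.5, Proposition 1.6, Proposition 1.9, Theorem 2.1, Proposition 2.6, Theorem 3.1 (iii).
* [IkedaYamamoto1979] A. Ikeda, Y. Yamamoto, *On the spectra of 3-dimensional lens spaces*, Osaka J. Math. 16 (1979) 447–469,
  Corollary 2.3 (the dictionary multiplicity = `dim H_k^G`).
-/

noncomputable section

open Finset Polynomial.Chebyshev

namespace Literature.Analysis.InnerProduct

open _root_.Real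

section PropOneSix
open Polynomial

variable {q : ℕ} [hq : Fact q.Prime]

/-- `∑_{l=1}^{q−1} ∏_{j<4}cos(2πla_j/q) = ⅛∑_{ξ,μ,ν=±1}(q·[q ∣ a + ξb + μc + νd] − 1)`. [cite: Ikeda1980, proof of Proposition
1.6 (the sum `∑_l∑γ^{(±p₁±p₂±p₃±p₄)l}` computing `a₄`)] -/
theorem sum_Ico_cos_mul_cos_mul_cos_mul_cos (a b c d : ℤ) :
    ∑ l ∈ Finset.Ico 1 q, Real.cos (2 * π * l * a / q) * Real.cos (2 * π * l * b / q) * Real.cos (2 * π * l * c / q) *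
        Real.cos (2 * π * l * d / q) =
      (((if (q : ℤ) ∣ a + b + c + d then (q : ℝ) else 0) + (if (q : ℤ) ∣ a + b + c - d then (q : ℝ) else 0) +
        (if (q : ℤ) ∣ a + b - c + d then (q : ℝ) else 0) + (if (q : ℤ) ∣ a + b - c - d then (q : ℝ) else 0) +
        (if (q : ℤ) ∣ a - b + c + d then (q : ℝ) else 0) + (if (q : ℤ) ∣ a - b + c - d then (q : ℝ) else 0) +
        (if (q : ℤ) ∣ a - b - c + d then (q : ℝ) else 0) + (if (q : ℤ) ∣ a - b - c - d then (q : ℝ) else 0)) - 8) / 8 := by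
  have e : ∀ l : ℕ, Real.cos (2 * π * l * a / q) * Real.cos (2 * π * l * b / q) * Real.cos (2 * π * l * c / q) *
      Real.cos (2 * π * l * d / q) =
      (Real.cos (2 * π * l * ((a + b + c + d : ℤ) : ℝ) / q) + Real.cos (2 * π * l * ((a + b + c - d : ℤ) : ℝ) / q) +
        Real.cos (2 * π * l * ((a + b - c + d : ℤ) : ℝ) / q) + Real.cos (2 * π * l * ((a + b - c - d : ℤ) : ℝ) / q) +
        Real.cos (2 * π * l * ((a - b + c + d : ℤ) : ℝ) / q) + Real.cos (2 * π * l * ((a - b + c - d : ℤ) : ℝ) / q) +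
        Real.cos (2 * π * l * ((a - b - c + d : ℤ) : ℝ) / q) + Real.cos (2 * π * l * ((a - b - c - d : ℤ) : ℝ) / q)) / 8 := by
    intro l
    have h1 : 2 * π * l * ((a + b + c + d : ℤ) : ℝ) / q =
        2 * π * l * a / q + 2 * π * l * b / q + 2 * π * l * c / q + 2 * π * l * d / q := by push_cast; ring
    have h2 : 2 * π * l * ((a + b + c - d : ℤ) : ℝ) / q =
        2 * π * l * a / q + 2 * π * l * b / q + 2 * π * l * c / q - 2 * π * l * d / q := by push_cast; ring
    have h3 : 2 * π * l * ((a + b - c + d : ℤ) : ℝ) / q =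
        2 * π * l * a / q + 2 * π * l * b / q - 2 * π * l * c / q + 2 * π * l * d / q := by push_cast; ring
    have h4 : 2 * π * l * ((a + b - c - d : ℤ) : ℝ) / q =
        2 * π * l * a / q + 2 * π * l * b / q - 2 * π * l * c / q - 2 * π * l * d / q := by push_cast; ring
    have h5 : 2 * π * l * ((a - b + c + d : ℤ) : ℝ) / q =
        2 * π * l * a / q - 2 * π * l * b / q + 2 * π * l * c / q + 2 * π * l * d / q := by push_cast; ring
    have h6 : 2 * π * l * ((a - b + c - d : ℤ) : ℝ) / q =
        2 * π * l * a / q - 2 * π * l * b / q + 2 * π * l * c / q - 2 * π * l * d / q := by push_cast; ring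
    have h7 : 2 * π * l * ((a - b - c + d : ℤ) : ℝ) / q =
        2 * π * l * a / q - 2 * π * l * b / q - 2 * π * l * c / q + 2 * π * l * d / q := by push_cast; ring
    have h8 : 2 * π * l * ((a - b - c - d : ℤ) : ℝ) / q =
        2 * π * l * a / q - 2 * π * l * b / q - 2 * π * l * c / q - 2 * π * l * d / q := by push_cast; ring
    rw [h1, h2, h3, h4, h5, h6, h7, h8]
    simp only [Real.cos_add, Real.cos_sub, Real.sin_add, Real.sin_sub]
    ring
  simp_rw [e]
  rw [← Finset.sum_div, Finset.sum_add_distrib, Finset.sum_add_distrib, Finset.sum_add_distrib, Finset.sum_add_distrib,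
    Finset.sum_add_distrib, Finset.sum_add_distrib, Finset.sum_add_distrib, sum_Ico_cos_two_pi_mul_div_eq,
    sum_Ico_cos_two_pi_mul_div_eq, sum_Ico_cos_two_pi_mul_div_eq, sum_Ico_cos_two_pi_mul_div_eq,
    sum_Ico_cos_two_pi_mul_div_eq, sum_Ico_cos_two_pi_mul_div_eq, sum_Ico_cos_two_pi_mul_div_eq,
    sum_Ico_cos_two_pi_mul_div_eq]
  ring

/-- One term of `Ψ_{q,4}`: `∏_{j<4}(z² − a_jz + 1) = (z⁸+1) − e₁(z⁷+z) + (4 + e₂)(z⁶+z²) − (3e₁ + e₃)(z⁵+z³) +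
(6 + 2e₂ + e₄)z⁴`, `aⱼ = 2cⱼ`, `eᵢ` the elementary symmetric functions of `(a₁, …, a₄)`
(`∏((z²+1) − a_jz) = ∑_m (−1)^m e_m z^m (z²+1)^{4−m}`). [cite: Ikeda1980, proof of Propositions 1.2 and 1.6] -/
private theorem prod_fin_four_quadratic (c : Fin 4 → ℝ) :
    ∏ i, (X ^ 2 - Polynomial.C (2 * c i) * X + 1 : ℝ[X]) =
      (X ^ 8 + 1) - Polynomial.C (2 * c 0 + 2 * c 1 + 2 * c 2 + 2 * c 3) * (X ^ 7 + X) +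
        Polynomial.C (4 + 4 * (c 0 * c 1 + c 0 * c 2 + c 0 * c 3 + c 1 * c 2 + c 1 * c 3 + c 2 * c 3)) * (X ^ 6 + X ^ 2) -
        Polynomial.C (3 * (2 * c 0 + 2 * c 1 + 2 * c 2 + 2 * c 3) +
          8 * (c 0 * c 1 * c 2 + c 0 * c 1 * c 3 + c 0 * c 2 * c 3 + c 1 * c 2 * c 3)) * (X ^ 5 + X ^ 3) +
        Polynomial.C (6 + 2 * (4 * (c 0 * c 1 + c 0 * c 2 + c 0 * c 3 + c 1 * c 2 + c 1 * c 3 + c 2 * c 3)) +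
          16 * (c 0 * c 1 * c 2 * c 3)) * X ^ 4 := by
  rw [Fin.prod_univ_four]
  simp only [map_add, map_mul, map_ofNat]
  ring

omit hq in
/-- `(if q ∣ M then q else 0) = q·[q ∣ M]`. [folklore] -/
private theorem ite_cast_eq_mul_t4 (M : ℤ) : (if (q : ℤ) ∣ M then (q : ℝ) else 0) = (q : ℝ) * (if (q : ℤ) ∣ M then 1 else 0) :=
  (mul_boole _ _).symm

/-- The three-cosine sum with the indicator count factored: `∑_{l=1}^{q−1}c_ac_bc_c = (q·|A_q(a,b,c)| − 4)/4`.
[cite: Ikeda1980, proof of Proposition 1.6] -/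
private theorem sum_Ico_cos_mul_cos_mul_cos_t4 (a b c : ℤ) :
    ∑ l ∈ Finset.Ico 1 q, Real.cos (2 * π * l * a / q) * Real.cos (2 * π * l * b / q) * Real.cos (2 * π * l * c / q) =
      ((q : ℝ) * ((if (q : ℤ) ∣ a + b + c then (1 : ℝ) else 0) + (if (q : ℤ) ∣ a + b - c then (1 : ℝ) else 0) +
        (if (q : ℤ) ∣ a - b + c then (1 : ℝ) else 0) + (if (q : ℤ) ∣ a - b - c then (1 : ℝ) else 0)) - 4) / 4 := by
  rw [sum_Ico_cos_mul_cos_mul_cos]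
  simp only [ite_cast_eq_mul_t4]
  ring

/-- The four-cosine sum with the indicator count factored: `∑_{l=1}^{q−1}c_ac_bc_cc_d = (q·|A_q(a,b,c,d)| − 8)/8`.
[cite: Ikeda1980, proof of Proposition 1.6] -/
private theorem sum_Ico_cos_mul_cos_mul_cos_mul_cos_t4 (a b c d : ℤ) :
    ∑ l ∈ Finset.Ico 1 q, Real.cos (2 * π * l * a / q) * Real.cos (2 * π * l * b / q) * Real.cos (2 * π * l * c / q) *
        Real.cos (2 * π * l * d / q) =
      ((q : ℝ) * ((if (q : ℤ) ∣ a + b + c + d then (1 : ℝ) else 0) + (if (q : ℤ) ∣ a + b + c - d then (1 : ℝ) else 0) +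
        (if (q : ℤ) ∣ a + b - c + d then (1 : ℝ) else 0) + (if (q : ℤ) ∣ a + b - c - d then (1 : ℝ) else 0) +
        (if (q : ℤ) ∣ a - b + c + d then (1 : ℝ) else 0) + (if (q : ℤ) ∣ a - b + c - d then (1 : ℝ) else 0) +
        (if (q : ℤ) ∣ a - b - c + d then (1 : ℝ) else 0) + (if (q : ℤ) ∣ a - b - c - d then (1 : ℝ) else 0)) - 8) / 8 := by
  rw [sum_Ico_cos_mul_cos_mul_cos_mul_cos]
  simp only [ite_cast_eq_mul_t4]
  ring

/-- **PROPOSITION 1.2 FOR `k = 4` WITH THE COEFFICIENTS `a₃`, `a₄` (Ikeda 1980): for `ω = (ω₁, …, ω₄) ∈ Ĩ₀(q, 4)`,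
`Ψ_{q,4}(ω) = (q−1)(z⁸+1) + 8(z⁷+z) + (4q−28)(z⁶+z²) + (56 − 2q·Σ|A_q(ω_{i₁},ω_{i₂},ω_{i₃})|)(z⁵+z³) +
(2q·|A_q(ω₁,ω₂,ω₃,ω₄)| + 6q − 70)z⁴`**, where `|A_q(p₁,p₂,p₃)| = #{(ξ,μ) ∈ {±1}² : p₁ + ξp₂ + μp₃ ≡ 0}` (summed over the
four triples `i₁ < i₂ < i₃`) and `|A_q(p₁,p₂,p₃,p₄)| = #{(ξ,μ,ν) ∈ {±1}³ : p₁ + ξp₂ + μp₃ + νp₄ ≡ 0 (mod q)}`, written out as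
sums of indicators: `a₀ = q − 1`, `a₁ = −2k = −8`, `a₂ = k(q − 2k + 1) = 4q − 28` (Proposition 1.2) and, from
`∑_{l=1}^{q−1}γ^{ml} = q[q ∣ m] − 1`, "`a₃ = 2(q−1)Σ|A_q(p_{i₁},p_{i₂},p_{i₃})| − 2(16 − Σ|A_q(p_{i₁},p_{i₂},p_{i₃})|) − 24`"
`= 2qΣ|A_q| − 56` and "`a₄ = 2q|A_q(p₁,p₂,p₃,p₄)| + 6q − 70`". [cite: Ikeda1980, Proposition 1.2 and the computation of `a₃`,
`a₄` preceding Proposition 1.6 (p. 307–308)] -/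
theorem IsIkedaWeights.ikedaPolynomial_fin_four {ω : Fin 4 → ℤ} (hω : IsIkedaWeights q ω) :
    ikedaPolynomial q ω =
      Polynomial.C ((q : ℝ) - 1) * (X ^ 8 + 1) + Polynomial.C 8 * (X ^ 7 + X) +
        Polynomial.C (4 * (q : ℝ) - 28) * (X ^ 6 + X ^ 2) +
        Polynomial.C (56 - 2 * (q : ℝ) *
          ((if (q : ℤ) ∣ ω 0 + ω 1 + ω 2 then (1 : ℝ) else 0) + (if (q : ℤ) ∣ ω 0 + ω 1 - ω 2 then (1 : ℝ) else 0) + (if (q : ℤ) ∣ ω 0 - ω 1 + ω 2 then (1 : ℝ) else 0) + (if (q : ℤ) ∣ ω 0 - ω 1 - ω 2 then (1 : ℝ) else 0) +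
          ((if (q : ℤ) ∣ ω 0 + ω 1 + ω 3 then (1 : ℝ) else 0) + (if (q : ℤ) ∣ ω 0 + ω 1 - ω 3 then (1 : ℝ) else 0) + (if (q : ℤ) ∣ ω 0 - ω 1 + ω 3 then (1 : ℝ) else 0) + (if (q : ℤ) ∣ ω 0 - ω 1 - ω 3 then (1 : ℝ) else 0)) +
          ((if (q : ℤ) ∣ ω 0 + ω 2 + ω 3 then (1 : ℝ) else 0) + (if (q : ℤ) ∣ ω 0 + ω 2 - ω 3 then (1 : ℝ) else 0) + (if (q : ℤ) ∣ ω 0 - ω 2 + ω 3 then (1 : ℝ) else 0) + (if (q : ℤ) ∣ ω 0 - ω 2 - ω 3 then (1 : ℝ) else 0)) +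
          ((if (q : ℤ) ∣ ω 1 + ω 2 + ω 3 then (1 : ℝ) else 0) + (if (q : ℤ) ∣ ω 1 + ω 2 - ω 3 then (1 : ℝ) else 0) + (if (q : ℤ) ∣ ω 1 - ω 2 + ω 3 then (1 : ℝ) else 0) + (if (q : ℤ) ∣ ω 1 - ω 2 - ω 3 then (1 : ℝ) else 0)))) * (X ^ 5 + X ^ 3) +
        Polynomial.C (2 * (q : ℝ) *
          ((if (q : ℤ) ∣ ω 0 + ω 1 + ω 2 + ω 3 then (1 : ℝ) else 0) + (if (q : ℤ) ∣ ω 0 + ω 1 + ω 2 - ω 3 then (1 : ℝ) else 0) +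
          (if (q : ℤ) ∣ ω 0 + ω 1 - ω 2 + ω 3 then (1 : ℝ) else 0) + (if (q : ℤ) ∣ ω 0 + ω 1 - ω 2 - ω 3 then (1 : ℝ) else 0) +
          (if (q : ℤ) ∣ ω 0 - ω 1 + ω 2 + ω 3 then (1 : ℝ) else 0) + (if (q : ℤ) ∣ ω 0 - ω 1 + ω 2 - ω 3 then (1 : ℝ) else 0) +
          (if (q : ℤ) ∣ ω 0 - ω 1 - ω 2 + ω 3 then (1 : ℝ) else 0) + (if (q : ℤ) ∣ ω 0 - ω 1 - ω 2 - ω 3 then (1 : ℝ) else 0)) + 6 * (q : ℝ) - 70) * X ^ 4 := by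
  have hq1 : 1 ≤ q := hq.out.one_lt.le
  have hn : ∀ i, ¬(q : ℤ) ∣ ω i := hω.not_dvd
  have hs : ∀ i j, i ≠ j → ¬(q : ℤ) ∣ ω i - ω j := hω.not_dvd_sub
  have ha : ∀ i j, i ≠ j → ¬(q : ℤ) ∣ ω i + ω j := hω.not_dvd_add
  -- `∑_l e₁ = −8`
  have hu : ∑ l ∈ Finset.Ico 1 q, (2 * Real.cos (2 * π * l * ω 0 / q) + 2 * Real.cos (2 * π * l * ω 1 / q) +
      2 * Real.cos (2 * π * l * ω 2 / q) + 2 * Real.cos (2 * π * l * ω 3 / q)) = -8 := by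
    rw [Finset.sum_add_distrib, Finset.sum_add_distrib, Finset.sum_add_distrib, ← Finset.mul_sum, ← Finset.mul_sum,
      ← Finset.mul_sum, ← Finset.mul_sum, sum_Ico_cos_two_pi_mul_div (hn 0), sum_Ico_cos_two_pi_mul_div (hn 1),
      sum_Ico_cos_two_pi_mul_div (hn 2), sum_Ico_cos_two_pi_mul_div (hn 3)]
    norm_num
  -- `∑_l ∑_{i<j} cᵢcⱼ = −6`
  have hpairs : ∑ l ∈ Finset.Ico 1 q, (Real.cos (2 * π * l * ω 0 / q) * Real.cos (2 * π * l * ω 1 / q) +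
      Real.cos (2 * π * l * ω 0 / q) * Real.cos (2 * π * l * ω 2 / q) +
      Real.cos (2 * π * l * ω 0 / q) * Real.cos (2 * π * l * ω 3 / q) +
      Real.cos (2 * π * l * ω 1 / q) * Real.cos (2 * π * l * ω 2 / q) +
      Real.cos (2 * π * l * ω 1 / q) * Real.cos (2 * π * l * ω 3 / q) +
      Real.cos (2 * π * l * ω 2 / q) * Real.cos (2 * π * l * ω 3 / q)) = -6 := by
    rw [Finset.sum_add_distrib, Finset.sum_add_distrib, Finset.sum_add_distrib, Finset.sum_add_distrib,
      Finset.sum_add_distrib, sum_Ico_cos_mul_cos (hs 0 1 (by decide)) (ha 0 1 (by decide)),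
      sum_Ico_cos_mul_cos (hs 0 2 (by decide)) (ha 0 2 (by decide)), sum_Ico_cos_mul_cos (hs 0 3 (by decide)) (ha 0 3 (by decide)),
      sum_Ico_cos_mul_cos (hs 1 2 (by decide)) (ha 1 2 (by decide)), sum_Ico_cos_mul_cos (hs 1 3 (by decide)) (ha 1 3 (by decide)),
      sum_Ico_cos_mul_cos (hs 2 3 (by decide)) (ha 2 3 (by decide))]
    norm_num
  have hw : ∑ l ∈ Finset.Ico 1 q, (4 + 4 * (Real.cos (2 * π * l * ω 0 / q) * Real.cos (2 * π * l * ω 1 / q) +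
      Real.cos (2 * π * l * ω 0 / q) * Real.cos (2 * π * l * ω 2 / q) +
      Real.cos (2 * π * l * ω 0 / q) * Real.cos (2 * π * l * ω 3 / q) +
      Real.cos (2 * π * l * ω 1 / q) * Real.cos (2 * π * l * ω 2 / q) +
      Real.cos (2 * π * l * ω 1 / q) * Real.cos (2 * π * l * ω 3 / q) +
      Real.cos (2 * π * l * ω 2 / q) * Real.cos (2 * π * l * ω 3 / q))) = 4 * (q : ℝ) - 28 := by
    rw [Finset.sum_add_distrib, Finset.sum_const, Nat.card_Ico, nsmul_eq_mul, Nat.cast_sub hq1, ← Finset.mul_sum, hpairs]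
    push_cast
    ring
  -- `∑_l ∑_{i<j<m} cᵢcⱼc_m = (q·Σ|A_q(triples)| − 16)/4`
  have htrip : ∑ l ∈ Finset.Ico 1 q,
      (Real.cos (2 * π * l * ω 0 / q) * Real.cos (2 * π * l * ω 1 / q) * Real.cos (2 * π * l * ω 2 / q) +
      Real.cos (2 * π * l * ω 0 / q) * Real.cos (2 * π * l * ω 1 / q) * Real.cos (2 * π * l * ω 3 / q) +
      Real.cos (2 * π * l * ω 0 / q) * Real.cos (2 * π * l * ω 2 / q) * Real.cos (2 * π * l * ω 3 / q) +
      Real.cos (2 * π * l * ω 1 / q) * Real.cos (2 * π * l * ω 2 / q) * Real.cos (2 * π * l * ω 3 / q)) =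
      ((q : ℝ) * ((if (q : ℤ) ∣ ω 0 + ω 1 + ω 2 then (1 : ℝ) else 0) + (if (q : ℤ) ∣ ω 0 + ω 1 - ω 2 then (1 : ℝ) else 0) + (if (q : ℤ) ∣ ω 0 - ω 1 + ω 2 then (1 : ℝ) else 0) + (if (q : ℤ) ∣ ω 0 - ω 1 - ω 2 then (1 : ℝ) else 0) +
          ((if (q : ℤ) ∣ ω 0 + ω 1 + ω 3 then (1 : ℝ) else 0) + (if (q : ℤ) ∣ ω 0 + ω 1 - ω 3 then (1 : ℝ) else 0) + (if (q : ℤ) ∣ ω 0 - ω 1 + ω 3 then (1 : ℝ) else 0) + (if (q : ℤ) ∣ ω 0 - ω 1 - ω 3 then (1 : ℝ) else 0)) +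
          ((if (q : ℤ) ∣ ω 0 + ω 2 + ω 3 then (1 : ℝ) else 0) + (if (q : ℤ) ∣ ω 0 + ω 2 - ω 3 then (1 : ℝ) else 0) + (if (q : ℤ) ∣ ω 0 - ω 2 + ω 3 then (1 : ℝ) else 0) + (if (q : ℤ) ∣ ω 0 - ω 2 - ω 3 then (1 : ℝ) else 0)) +
          ((if (q : ℤ) ∣ ω 1 + ω 2 + ω 3 then (1 : ℝ) else 0) + (if (q : ℤ) ∣ ω 1 + ω 2 - ω 3 then (1 : ℝ) else 0) + (if (q : ℤ) ∣ ω 1 - ω 2 + ω 3 then (1 : ℝ) else 0) + (if (q : ℤ) ∣ ω 1 - ω 2 - ω 3 then (1 : ℝ) else 0))) - 16) / 4 := by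
    rw [Finset.sum_add_distrib, Finset.sum_add_distrib, Finset.sum_add_distrib, sum_Ico_cos_mul_cos_mul_cos_t4,
      sum_Ico_cos_mul_cos_mul_cos_t4, sum_Ico_cos_mul_cos_mul_cos_t4, sum_Ico_cos_mul_cos_mul_cos_t4]
    ring
  have hv : ∑ l ∈ Finset.Ico 1 q, (3 * (2 * Real.cos (2 * π * l * ω 0 / q) + 2 * Real.cos (2 * π * l * ω 1 / q) +
      2 * Real.cos (2 * π * l * ω 2 / q) + 2 * Real.cos (2 * π * l * ω 3 / q)) +
      8 * (Real.cos (2 * π * l * ω 0 / q) * Real.cos (2 * π * l * ω 1 / q) * Real.cos (2 * π * l * ω 2 / q) +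
      Real.cos (2 * π * l * ω 0 / q) * Real.cos (2 * π * l * ω 1 / q) * Real.cos (2 * π * l * ω 3 / q) +
      Real.cos (2 * π * l * ω 0 / q) * Real.cos (2 * π * l * ω 2 / q) * Real.cos (2 * π * l * ω 3 / q) +
      Real.cos (2 * π * l * ω 1 / q) * Real.cos (2 * π * l * ω 2 / q) * Real.cos (2 * π * l * ω 3 / q))) =
      -(56 - 2 * (q : ℝ) * ((if (q : ℤ) ∣ ω 0 + ω 1 + ω 2 then (1 : ℝ) else 0) + (if (q : ℤ) ∣ ω 0 + ω 1 - ω 2 then (1 : ℝ) else 0) + (if (q : ℤ) ∣ ω 0 - ω 1 + ω 2 then (1 : ℝ) else 0) + (if (q : ℤ) ∣ ω 0 - ω 1 - ω 2 then (1 : ℝ) else 0) +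
          ((if (q : ℤ) ∣ ω 0 + ω 1 + ω 3 then (1 : ℝ) else 0) + (if (q : ℤ) ∣ ω 0 + ω 1 - ω 3 then (1 : ℝ) else 0) + (if (q : ℤ) ∣ ω 0 - ω 1 + ω 3 then (1 : ℝ) else 0) + (if (q : ℤ) ∣ ω 0 - ω 1 - ω 3 then (1 : ℝ) else 0)) +
          ((if (q : ℤ) ∣ ω 0 + ω 2 + ω 3 then (1 : ℝ) else 0) + (if (q : ℤ) ∣ ω 0 + ω 2 - ω 3 then (1 : ℝ) else 0) + (if (q : ℤ) ∣ ω 0 - ω 2 + ω 3 then (1 : ℝ) else 0) + (if (q : ℤ) ∣ ω 0 - ω 2 - ω 3 then (1 : ℝ) else 0)) +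
          ((if (q : ℤ) ∣ ω 1 + ω 2 + ω 3 then (1 : ℝ) else 0) + (if (q : ℤ) ∣ ω 1 + ω 2 - ω 3 then (1 : ℝ) else 0) + (if (q : ℤ) ∣ ω 1 - ω 2 + ω 3 then (1 : ℝ) else 0) + (if (q : ℤ) ∣ ω 1 - ω 2 - ω 3 then (1 : ℝ) else 0)))) := by
    rw [Finset.sum_add_distrib, ← Finset.mul_sum, ← Finset.mul_sum, hu, htrip]
    ring
  -- `∑_l c₀c₁c₂c₃ = (q·|A_q(ω)| − 8)/8`
  have hquad := sum_Ico_cos_mul_cos_mul_cos_mul_cos_t4 (q := q) (ω 0) (ω 1) (ω 2) (ω 3)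
  have hx : ∑ l ∈ Finset.Ico 1 q, (6 + 2 * (4 * (Real.cos (2 * π * l * ω 0 / q) * Real.cos (2 * π * l * ω 1 / q) +
      Real.cos (2 * π * l * ω 0 / q) * Real.cos (2 * π * l * ω 2 / q) +
      Real.cos (2 * π * l * ω 0 / q) * Real.cos (2 * π * l * ω 3 / q) +
      Real.cos (2 * π * l * ω 1 / q) * Real.cos (2 * π * l * ω 2 / q) +
      Real.cos (2 * π * l * ω 1 / q) * Real.cos (2 * π * l * ω 3 / q) +
      Real.cos (2 * π * l * ω 2 / q) * Real.cos (2 * π * l * ω 3 / q))) +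
      16 * (Real.cos (2 * π * l * ω 0 / q) * Real.cos (2 * π * l * ω 1 / q) * Real.cos (2 * π * l * ω 2 / q) *
        Real.cos (2 * π * l * ω 3 / q))) =
      2 * (q : ℝ) * ((if (q : ℤ) ∣ ω 0 + ω 1 + ω 2 + ω 3 then (1 : ℝ) else 0) + (if (q : ℤ) ∣ ω 0 + ω 1 + ω 2 - ω 3 then (1 : ℝ) else 0) +
          (if (q : ℤ) ∣ ω 0 + ω 1 - ω 2 + ω 3 then (1 : ℝ) else 0) + (if (q : ℤ) ∣ ω 0 + ω 1 - ω 2 - ω 3 then (1 : ℝ) else 0) +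
          (if (q : ℤ) ∣ ω 0 - ω 1 + ω 2 + ω 3 then (1 : ℝ) else 0) + (if (q : ℤ) ∣ ω 0 - ω 1 + ω 2 - ω 3 then (1 : ℝ) else 0) +
          (if (q : ℤ) ∣ ω 0 - ω 1 - ω 2 + ω 3 then (1 : ℝ) else 0) + (if (q : ℤ) ∣ ω 0 - ω 1 - ω 2 - ω 3 then (1 : ℝ) else 0)) + 6 * (q : ℝ) - 70 := by
    rw [Finset.sum_add_distrib, Finset.sum_add_distrib, Finset.sum_const, Nat.card_Ico, nsmul_eq_mul, Nat.cast_sub hq1,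
      ← Finset.mul_sum, ← Finset.mul_sum, hpairs, ← Finset.mul_sum, hquad]
    push_cast
    ring
  unfold ikedaPolynomial
  rw [Finset.sum_congr rfl fun (l : ℕ) _ ↦ prod_fin_four_quadratic (fun i ↦ Real.cos (2 * π * l * ω i / q)),
    Finset.sum_add_distrib, Finset.sum_sub_distrib, Finset.sum_add_distrib, Finset.sum_sub_distrib, Finset.sum_const,
    Nat.card_Ico, ← Finset.sum_mul, ← Finset.sum_mul, ← Finset.sum_mul, ← Finset.sum_mul, ← map_sum, ← map_sum,
    ← map_sum, ← map_sum, hu, hw, hv, hx, nsmul_eq_mul, Nat.cast_sub hq1]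
  simp only [Nat.cast_one, map_sub, map_one, map_mul, map_neg, map_ofNat, map_add]
  rw [← Polynomial.C_eq_natCast]
  ring

/-- **PROPOSITION 1.6 (Ikeda 1980): for `ω, ω' ∈ Ĩ₀(q, 4)`, `Ψ_{q,4}(ω) = Ψ_{q,4}(ω')` as soon as (i)
`Σ_{i₁<i₂<i₃}|A_q(ω_{i₁},ω_{i₂},ω_{i₃})| = Σ|A_q(ω'_{i₁},ω'_{i₂},ω'_{i₃})|` and (ii) `|A_q(ω)| = |A_q(ω')|`** (the printed
"if and only if"; this is the direction used for Theorem 3.1 (iii)). [cite: Ikeda1980, Proposition 1.6] -/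
theorem IsIkedaWeights.ikedaPolynomial_fin_four_eq {ω ω' : Fin 4 → ℤ} (hω : IsIkedaWeights q ω) (hω' : IsIkedaWeights q ω')
    (hS : ((if (q : ℤ) ∣ ω 0 + ω 1 + ω 2 then (1 : ℝ) else 0) + (if (q : ℤ) ∣ ω 0 + ω 1 - ω 2 then (1 : ℝ) else 0) + (if (q : ℤ) ∣ ω 0 - ω 1 + ω 2 then (1 : ℝ) else 0) + (if (q : ℤ) ∣ ω 0 - ω 1 - ω 2 then (1 : ℝ) else 0) +
          ((if (q : ℤ) ∣ ω 0 + ω 1 + ω 3 then (1 : ℝ) else 0) + (if (q : ℤ) ∣ ω 0 + ω 1 - ω 3 then (1 : ℝ) else 0) + (if (q : ℤ) ∣ ω 0 - ω 1 + ω 3 then (1 : ℝ) else 0) + (if (q : ℤ) ∣ ω 0 - ω 1 - ω 3 then (1 : ℝ) else 0)) +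
          ((if (q : ℤ) ∣ ω 0 + ω 2 + ω 3 then (1 : ℝ) else 0) + (if (q : ℤ) ∣ ω 0 + ω 2 - ω 3 then (1 : ℝ) else 0) + (if (q : ℤ) ∣ ω 0 - ω 2 + ω 3 then (1 : ℝ) else 0) + (if (q : ℤ) ∣ ω 0 - ω 2 - ω 3 then (1 : ℝ) else 0)) +
          ((if (q : ℤ) ∣ ω 1 + ω 2 + ω 3 then (1 : ℝ) else 0) + (if (q : ℤ) ∣ ω 1 + ω 2 - ω 3 then (1 : ℝ) else 0) + (if (q : ℤ) ∣ ω 1 - ω 2 + ω 3 then (1 : ℝ) else 0) + (if (q : ℤ) ∣ ω 1 - ω 2 - ω 3 then (1 : ℝ) else 0))) =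
      ((if (q : ℤ) ∣ ω' 0 + ω' 1 + ω' 2 then (1 : ℝ) else 0) + (if (q : ℤ) ∣ ω' 0 + ω' 1 - ω' 2 then (1 : ℝ) else 0) + (if (q : ℤ) ∣ ω' 0 - ω' 1 + ω' 2 then (1 : ℝ) else 0) + (if (q : ℤ) ∣ ω' 0 - ω' 1 - ω' 2 then (1 : ℝ) else 0) +
          ((if (q : ℤ) ∣ ω' 0 + ω' 1 + ω' 3 then (1 : ℝ) else 0) + (if (q : ℤ) ∣ ω' 0 + ω' 1 - ω' 3 then (1 : ℝ) else 0) + (if (q : ℤ) ∣ ω' 0 - ω' 1 + ω' 3 then (1 : ℝ) else 0) + (if (q : ℤ) ∣ ω' 0 - ω' 1 - ω' 3 then (1 : ℝ) else 0)) +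
          ((if (q : ℤ) ∣ ω' 0 + ω' 2 + ω' 3 then (1 : ℝ) else 0) + (if (q : ℤ) ∣ ω' 0 + ω' 2 - ω' 3 then (1 : ℝ) else 0) + (if (q : ℤ) ∣ ω' 0 - ω' 2 + ω' 3 then (1 : ℝ) else 0) + (if (q : ℤ) ∣ ω' 0 - ω' 2 - ω' 3 then (1 : ℝ) else 0)) +
          ((if (q : ℤ) ∣ ω' 1 + ω' 2 + ω' 3 then (1 : ℝ) else 0) + (if (q : ℤ) ∣ ω' 1 + ω' 2 - ω' 3 then (1 : ℝ) else 0) + (if (q : ℤ) ∣ ω' 1 - ω' 2 + ω' 3 then (1 : ℝ) else 0) + (if (q : ℤ) ∣ ω' 1 - ω' 2 - ω' 3 then (1 : ℝ) else 0))))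
    (hN : ((if (q : ℤ) ∣ ω 0 + ω 1 + ω 2 + ω 3 then (1 : ℝ) else 0) + (if (q : ℤ) ∣ ω 0 + ω 1 + ω 2 - ω 3 then (1 : ℝ) else 0) +
          (if (q : ℤ) ∣ ω 0 + ω 1 - ω 2 + ω 3 then (1 : ℝ) else 0) + (if (q : ℤ) ∣ ω 0 + ω 1 - ω 2 - ω 3 then (1 : ℝ) else 0) +
          (if (q : ℤ) ∣ ω 0 - ω 1 + ω 2 + ω 3 then (1 : ℝ) else 0) + (if (q : ℤ) ∣ ω 0 - ω 1 + ω 2 - ω 3 then (1 : ℝ) else 0) +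
          (if (q : ℤ) ∣ ω 0 - ω 1 - ω 2 + ω 3 then (1 : ℝ) else 0) + (if (q : ℤ) ∣ ω 0 - ω 1 - ω 2 - ω 3 then (1 : ℝ) else 0)) =
      ((if (q : ℤ) ∣ ω' 0 + ω' 1 + ω' 2 + ω' 3 then (1 : ℝ) else 0) + (if (q : ℤ) ∣ ω' 0 + ω' 1 + ω' 2 - ω' 3 then (1 : ℝ) else 0) +
          (if (q : ℤ) ∣ ω' 0 + ω' 1 - ω' 2 + ω' 3 then (1 : ℝ) else 0) + (if (q : ℤ) ∣ ω' 0 + ω' 1 - ω' 2 - ω' 3 then (1 : ℝ) else 0) +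
          (if (q : ℤ) ∣ ω' 0 - ω' 1 + ω' 2 + ω' 3 then (1 : ℝ) else 0) + (if (q : ℤ) ∣ ω' 0 - ω' 1 + ω' 2 - ω' 3 then (1 : ℝ) else 0) +
          (if (q : ℤ) ∣ ω' 0 - ω' 1 - ω' 2 + ω' 3 then (1 : ℝ) else 0) + (if (q : ℤ) ∣ ω' 0 - ω' 1 - ω' 2 - ω' 3 then (1 : ℝ) else 0))) :
    ikedaPolynomial q ω = ikedaPolynomial q ω' := by
  rw [hω.ikedaPolynomial_fin_four, hω'.ikedaPolynomial_fin_four, hS, hN]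

end PropOneSix

/-! ### §2 The witnesses `(1, 2, 3, 7)`, `(1, 2, 3, 8) ∈ Ĩ₀(q, 4)` -/

section Witnesses

variable {q : ℕ} [hq : Fact q.Prime]

omit hq in
/-- `q ∤ m` for `0 < |m| < q`. [folklore] -/
private theorem not_dvd_of_abs_lt_t4 {m : ℤ} (hm : m ≠ 0) (hlt : |m| < q) : ¬((q : ℤ) ∣ m) := fun hd ↦
  hm (Int.eq_zero_of_abs_lt_dvd hd hlt)

/-- An integer `r` with `1 ≤ r ≤ q − 1` is prime to the prime `q`. [folklore] -/
private theorem isCoprime_of_pos_of_lt_t4 {r : ℤ} (h1 : 1 ≤ r) (h2 : r < q) : IsCoprime r q := by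
  lift r to ℕ using (by omega : 0 ≤ r)
  rw [Nat.isCoprime_iff_coprime]
  exact ((Nat.Prime.coprime_iff_not_dvd hq.out).mpr (Nat.not_dvd_of_pos_of_lt (by omega) (by omega))).symm

/-- `(1, 2, 3, 7) ∈ Ĩ₀(q, 4)` for a prime `q ≥ 11`. [cite: Ikeda1980, §1 (1.1)] -/
theorem isIkedaWeights_one_two_three_seven (hq11 : 11 ≤ q) : IsIkedaWeights q ![1, 2, 3, 7] where
  isCoprime i := by
    have hq' : (11 : ℤ) ≤ q := by exact_mod_cast hq11
    fin_cases i <;> exact isCoprime_of_pos_of_lt_t4 (by simp) (by simp; linarith)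
  not_dvd_sub i j hij := by
    have hq' : (11 : ℤ) ≤ q := by exact_mod_cast hq11
    fin_cases i <;> fin_cases j <;>
      first | exact absurd rfl hij | exact not_dvd_of_abs_lt_t4 (by simp) (by simp; linarith)
  not_dvd_add i j hij := by
    have hq' : (11 : ℤ) ≤ q := by exact_mod_cast hq11
    fin_cases i <;> fin_cases j <;>
      first | exact absurd rfl hij | exact not_dvd_of_abs_lt_t4 (by simp) (by simp; linarith)

/-- `(1, 2, 3, 8) ∈ Ĩ₀(q, 4)` for a prime `q ≥ 13`. [cite: Ikeda1980, §1 (1.1)] -/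
theorem isIkedaWeights_one_two_three_eight (hq13 : 13 ≤ q) : IsIkedaWeights q ![1, 2, 3, 8] where
  isCoprime i := by
    have hq' : (13 : ℤ) ≤ q := by exact_mod_cast hq13
    fin_cases i <;> exact isCoprime_of_pos_of_lt_t4 (by simp) (by simp; linarith)
  not_dvd_sub i j hij := by
    have hq' : (13 : ℤ) ≤ q := by exact_mod_cast hq13
    fin_cases i <;> fin_cases j <;>
      first | exact absurd rfl hij | exact not_dvd_of_abs_lt_t4 (by simp) (by simp; linarith)
  not_dvd_add i j hij := by
    have hq' : (13 : ℤ) ≤ q := by exact_mod_cast hq13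
    fin_cases i <;> fin_cases j <;>
      first | exact absurd rfl hij | exact not_dvd_of_abs_lt_t4 (by simp) (by simp; linarith)

omit hq in
/-- A prime `q ≥ 7` does not divide `270 = 2·3³·5`. [folklore] -/
private theorem not_dvd_270_t4 (hp : q.Prime) (hq7 : 7 ≤ q) : ¬ q ∣ 270 := by
  intro hd
  have h' : q ∣ 2 * (3 ^ 3 * 5) := by norm_num; exact hd
  rcases (Nat.Prime.dvd_mul hp).mp h' with h2 | h'
  · exact absurd (Nat.le_of_dvd two_pos h2) (by omega)
  rcases (Nat.Prime.dvd_mul hp).mp h' with h3 | h5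
  · exact absurd (Nat.le_of_dvd (by norm_num) (hp.dvd_of_dvd_pow h3)) (by omega)
  · exact absurd (Nat.le_of_dvd (by norm_num) h5) (by omega)

/-- **`(1, 2, 3, 7)` and `(1, 2, 3, 8)` are not equivalent in `Ĩ₀(q, 4)` for a prime `q ≥ 7`** (so `Ψ̃_{q,4}` is not injective
for `q ≥ 17`, both having the same invariants of Proposition 1.6 — the inequality driving Theorem 3.1 (iii)): an equivalence
`p_{σ(i)} ≡ e_i l s_i` gives, on summing squares, fourth and sixth powers (`e_i² = 1`), `63 ≡ 78l²`, `2499 ≡ 4194l⁴`,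
`118443 ≡ 262938l⁶ (mod q)`, whence `q ∣ 4194·63² − 78²·2499 = 1442070 = 2·3³·5·7²·109` and
`q ∣ 262938·63³ − 78³·118443 = 9539495550 = 2·3⁴·5²·13·409·443`, so `q ∣ 270 = 2·3³·5`. [cite: Ikeda1980, proof of
Theorem 3.1 (iii) ("`Ψ̃_{q,4}` is not injective") with Proposition 1.6] -/
theorem not_lensWeightsEquivalent_one_two_three_seven_one_two_three_eight (hq7 : 7 ≤ q) :
    ¬LensWeightsEquivalent q ![1, 2, 3, 7] ![1, 2, 3, 8] := by
  rintro ⟨l, e, he, σ, hσ⟩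
  -- in `ℤ/q`
  have hc : ∀ i, (((![1, 2, 3, 7] : Fin 4 → ℤ) (σ i) : ℤ) : ZMod q) =
      ((e i : ℤ) : ZMod q) * ((l : ℤ) : ZMod q) * (((![1, 2, 3, 8] : Fin 4 → ℤ) i : ℤ) : ZMod q) := fun i ↦ by
    have := (ZMod.intCast_eq_intCast_iff _ _ _).mpr (hσ i)
    push_cast at this
    exact this
  have he2 : ∀ i, ((e i : ℤ) : ZMod q) ^ 2 = 1 := fun i ↦ by rcases he i with h1 | h1 <;> simp [h1]
  have hsq : ∀ i, (((![1, 2, 3, 7] : Fin 4 → ℤ) (σ i) : ℤ) : ZMod q) ^ 2 =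
      ((l : ℤ) : ZMod q) ^ 2 * (((![1, 2, 3, 8] : Fin 4 → ℤ) i : ℤ) : ZMod q) ^ 2 := fun i ↦ by
    rw [hc i]; linear_combination (((l : ℤ) : ZMod q) ^ 2 * (((![1, 2, 3, 8] : Fin 4 → ℤ) i : ℤ) : ZMod q) ^ 2) * he2 i
  have hfour : ∀ i, (((![1, 2, 3, 7] : Fin 4 → ℤ) (σ i) : ℤ) : ZMod q) ^ 4 =
      ((l : ℤ) : ZMod q) ^ 4 * (((![1, 2, 3, 8] : Fin 4 → ℤ) i : ℤ) : ZMod q) ^ 4 := fun i ↦ by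
    rw [show (4 : ℕ) = 2 * 2 from rfl, pow_mul, hsq i]; ring
  have hsix : ∀ i, (((![1, 2, 3, 7] : Fin 4 → ℤ) (σ i) : ℤ) : ZMod q) ^ 6 =
      ((l : ℤ) : ZMod q) ^ 6 * (((![1, 2, 3, 8] : Fin 4 → ℤ) i : ℤ) : ZMod q) ^ 6 := fun i ↦ by
    rw [show (6 : ℕ) = 2 * 3 from rfl, pow_mul, hsq i]; ring
  -- the power sums are invariant under `σ`
  have s2 := Equiv.sum_comp σ (fun i ↦ (((![1, 2, 3, 7] : Fin 4 → ℤ) i : ℤ) : ZMod q) ^ 2)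
  have s4 := Equiv.sum_comp σ (fun i ↦ (((![1, 2, 3, 7] : Fin 4 → ℤ) i : ℤ) : ZMod q) ^ 4)
  have s6 := Equiv.sum_comp σ (fun i ↦ (((![1, 2, 3, 7] : Fin 4 → ℤ) i : ℤ) : ZMod q) ^ 6)
  simp only [hsq, hfour, hsix, ← Finset.mul_sum, Fin.sum_univ_four, Matrix.cons_val_zero, Matrix.cons_val_one,
    Matrix.cons_val_two, Matrix.cons_val_three, Matrix.tail_cons, Matrix.head_cons] at s2 s4 s6
  push_cast at s2 s4 s6
  -- `63 = 78 l²`, `2499 = 4194 l⁴`, `118443 = 262938 l⁶` in `ℤ/q`, hence `270 = 0`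
  have h0 : ((270 : ℤ) : ZMod q) = 0 := by
    push_cast
    linear_combination (11258969 * (4194 * (63 + ((l : ℤ) : ZMod q) ^ 2 * 78)) -
        1702 * (262938 * (63 ^ 2 + 63 * (((l : ℤ) : ZMod q) ^ 2 * 78) + (((l : ℤ) : ZMod q) ^ 2 * 78) ^ 2))) * s2 -
      (11258969 * 6084) * s4 + (1702 * 474552) * s6
  have hd : (q : ℤ) ∣ 270 := (ZMod.intCast_zmod_eq_zero_iff_dvd _ _).mp h0
  exact not_dvd_270_t4 hq.out hq7 (by exact_mod_cast hd)

end Witnesses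

/-! ### §3 THEOREM 3.1 (iii) -/

section TheoremThreeOne

variable {q : ℕ} [hq : Fact q.Prime]

/-- **IKEDA'S THEOREM 3.1 (iii), FOR EVERY PRIME `q ≥ 17`**: "let `q` be a prime not less than `17`. Then there exist at least
two `(q − 10)`-dimensional lens spaces with fundamental groups of order `q` which are isospectral but not isometric" — here:
`q = 2n + 11` and two weight systems `p, s ∈ Ĩ₀(q, n + 1)` (lens spaces `L(q : p)`, `L(q : s) = S^{2n+1}/ℤ_q` of dimension
`2n + 1 = q − 10`) with `dim E_m(L(q : p)) = dim E_m(L(q : s))` for every `m`, which are NOT equivalent in the sense of Theorem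
2.1 (4) — hence neither isometric nor diffeomorphic nor homeomorphic. The two systems are the complements of `(1, 2, 3, 7)` and
`(1, 2, 3, 8) ∈ Ĩ₀(q, 4)` in a full system of residues prime to `q` (both with `Σ|A_q(triples)| = 1` — the relation
`1 + 2 − 3 = 0` — and `|A_q| = 0`: Proposition 1.6 and Proposition 2.6 give the isospectrality; non-equivalence passes to
complements). The source argues by counting instead (`|𝓛₀(q,4)| > 6 ≥ |J(q,4)|`, Proposition 1.9 (ii)); the explicit pair
is a witness of that pigeonhole. [cite: Ikeda1980, Theorem 3.1 (iii) and its proof (p. 311), Proposition 1.6, Proposition 1.9,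
Proposition 2.6, Theorem 2.1] -/
theorem exists_isospectral_not_lensWeightsEquivalent_four (hq17 : 17 ≤ q) :
    ∃ n : ℕ, q = 2 * n + 11 ∧ ∃ p s : Fin (n + 1) → ℤ, IsIkedaWeights q p ∧ IsIkedaWeights q s ∧
      (∀ m, lensSpaceMultiplicity q p m = lensSpaceMultiplicity q s m) ∧ ¬LensWeightsEquivalent q p s := by
  have hq2 : q ≠ 2 := by omega
  obtain ⟨h, hh⟩ : Odd q := hq.out.odd_of_ne_two hq2
  obtain ⟨n, rfl⟩ : ∃ n, h = n + 5 := ⟨h - 5, by omega⟩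
  refine ⟨n, by omega, ?_⟩
  have h1237 := isIkedaWeights_one_two_three_seven (q := q) (by omega)
  have h1238 := isIkedaWeights_one_two_three_eight (q := q) (by omega)
  obtain ⟨ω, hω⟩ := h1237.exists_append (h := n + 5) (k := n + 1) (by omega) (by omega)
  obtain ⟨ω', hω'⟩ := h1238.exists_append (h := n + 5) (k := n + 1) (by omega) (by omega)
  refine ⟨ω, ω', hω.append_right, hω'.append_right, fun m ↦ ?_, fun heq ↦ ?_⟩
  · -- Proposition 2.6 with the complements `(1,2,3,7)`, `(1,2,3,8)`; Proposition 1.6 with equal invariants on both sides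
    refine (lensSpaceMultiplicity_eq_iff_ikedaPolynomial_eq (n := n) (k := 4) hq2 hω.append_comm hω'.append_comm
      (by omega)).mpr (h1237.ikedaPolynomial_fin_four_eq h1238 ?_ ?_) m
    · have hq' : (17 : ℤ) ≤ q := by exact_mod_cast hq17
      have nd : ∀ m : ℤ, m ≠ 0 → |m| < 17 → ¬ (q : ℤ) ∣ m := fun m hm hlt ↦
        not_dvd_of_abs_lt_t4 hm (lt_of_lt_of_le hlt hq')
      simp only [Matrix.cons_val_zero, Matrix.cons_val_one, Matrix.cons_val_two, Matrix.cons_val_three, Matrix.tail_cons,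
        Matrix.head_cons]
      norm_num
      simp only [if_neg (nd 6 (by norm_num) (by norm_num)), if_neg (nd 2 (by norm_num) (by norm_num)),
        if_neg (nd 4 (by norm_num) (by norm_num)), if_neg (nd 10 (by norm_num) (by norm_num)),
        if_neg (nd 8 (by norm_num) (by norm_num)), if_neg (nd 11 (by norm_num) (by norm_num)),
        if_neg (nd 3 (by norm_num) (by norm_num)), if_neg (nd 5 (by norm_num) (by norm_num)),
        if_neg (nd 9 (by norm_num) (by norm_num)), if_neg (nd 12 (by norm_num) (by norm_num)),
        if_neg (nd 13 (by norm_num) (by norm_num)), if_neg (nd 7 (by norm_num) (by norm_num))]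
    · have hq' : (17 : ℤ) ≤ q := by exact_mod_cast hq17
      have nd : ∀ m : ℤ, m ≠ 0 → |m| < 17 → ¬ (q : ℤ) ∣ m := fun m hm hlt ↦
        not_dvd_of_abs_lt_t4 hm (lt_of_lt_of_le hlt hq')
      simp only [Matrix.cons_val_zero, Matrix.cons_val_one, Matrix.cons_val_two, Matrix.cons_val_three, Matrix.tail_cons,
        Matrix.head_cons]
      norm_num
      simp only [if_neg (nd 13 (by norm_num) (by norm_num)), if_neg (nd 1 (by norm_num) (by norm_num)),
        if_neg (nd 7 (by norm_num) (by norm_num)), if_neg (nd 9 (by norm_num) (by norm_num)),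
        if_neg (nd 5 (by norm_num) (by norm_num)), if_neg (nd 3 (by norm_num) (by norm_num)),
        if_neg (nd 11 (by norm_num) (by norm_num)), if_neg (nd 14 (by norm_num) (by norm_num)),
        if_neg (nd 2 (by norm_num) (by norm_num)), if_neg (nd 8 (by norm_num) (by norm_num)),
        if_neg (nd 10 (by norm_num) (by norm_num)), if_neg (nd 6 (by norm_num) (by norm_num)),
        if_neg (nd 4 (by norm_num) (by norm_num)), if_neg (nd 12 (by norm_num) (by norm_num))]
  · exact not_lensWeightsEquivalent_one_two_three_seven_one_two_three_eight (by omega)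
      (LensWeightsEquivalent.of_append hq2 (h := n + 5) (by omega) (by omega) hω hω' heq)

end TheoremThreeOne

end Literature.Analysis.InnerProduct
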